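import Summits.AtomisticToContinuum.Crystallization.Theses.PricedLinkCensus

/-!
# Route PricedLinkCensus — item `Assembly` (stmt-AtomisticToContinuum-14994)

The assembly item of route `PricedLinkCensus` (sub-problem `Crystallization` of the summit
`AtomisticToContinuum`) is the implication

  `TruncatedCensusGap → LocalToGlobal → CrysEnergyUpper → GapConsequences →
   SoftLayerPropagation → LayeringGlue → StackingHinge → ChargedPatternCrystallizes →
   ChargedPeriodicIsOptimal → Crystallization`,

i.e. the nine binders of the route's deciding theorem
`Summit.AtomisticToContinuum.Crystallization.Theses.PricedLinkCensus.closes`, in the same order,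
imply the sub-problem statement `_root_.Crystallization`.  `closes` is sorry-free in the Theses
file (axioms `propext`, `Classical.choice`, `Quot.sound`), so the item is settled by unfolding
`Assembly` and invoking `closes`.

Route history.  Revisions ≤ 3 of the route stated the item with these nine hypotheses (items
14239, 13891); revision 4 (2026-08-16, route-repair "unused-crux", item 14733) hypothesised
`closes` on the priced Lennard-Jones gap `ChargedEnergyGap` directly (eight binders); revision 6
(2026-08-16, route-repair "crux-only", item 14994) returns to the nine-binder form, in which
`closes` takes the census cruxes `TruncatedCensusGap` and
`LocalToGlobal : TruncatedCensusGap → ChargedEnergyGap` and derives the priced gap as `hLG hT`, so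
that all five cruxes of the route lie in its cone.  The proof below is the same term under every
rendering (`closes`), because `Assembly` and `closes` are regenerated together from one binder
list.

Logic of `closes`, for the record: `hLG hT : ChargedEnergyGap`; `hGC (hLG hT) hUB` turns the
priced gap and the trial-state upper bound into `ZeroChargeBulk ∧ (E(N)/N → ⨅_Q e(Q))`; `hLGl`
gives charge-free windows and `hSH hSLP` the shared hinge `GroundStatesChargePeriodic`; conjunct
(ii) of `Crystallization` is `hCPC` with the proved `LennardJonesMinimalDistance_holds`; for
conjunct (i) some periodic `Q` is charged along an actual ground-state sequence
(`LennardJonesGroundStatesExist_holds`), `hCPO` makes `e(Q)` the least periodic value, and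
`IsLeast.csInf_eq` rewrites the energy limit as `E(N)/N → e(Q)`.

Nothing else is proved here; the nine hypotheses remain the route's items (the open ones are the
cruxes `TruncatedCensusGap`, `LocalToGlobal`, `SoftLayerPropagation`, `StackingHinge`; the binders
`CrysEnergyUpper`, `GapConsequences`, `LayeringGlue`, `ChargedPatternCrystallizes`,
`ChargedPeriodicIsOptimal` are proved in tree under `Theorems/PricedLinkCensus*.lean` and
`Theorems/PalmUnimodularRigidityChargedPatternCrystallizes.lean`).
-/

namespace Summit.AtomisticToContinuum.Crystallization.Theorems

open Summit.AtomisticToContinuum.Crystallization.Theses.PricedLinkCensus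

/-- **Item `Assembly`** (stmt-AtomisticToContinuum-14994, route PricedLinkCensus, rev 6): the
nine binders `TruncatedCensusGap`, `LocalToGlobal`, `CrysEnergyUpper`, `GapConsequences`,
`SoftLayerPropagation`, `LayeringGlue`, `StackingHinge`, `ChargedPatternCrystallizes`,
`ChargedPeriodicIsOptimal` imply `Crystallization` — literally the route's deciding theorem
`Theses.PricedLinkCensus.closes` (earlier renderings of the same item: 14239, 13891 with nine
binders; 14733 with eight, `ChargedEnergyGap` in place of the first two). [folklore] -/
theorem assembly_proof : Theses.PricedLinkCensus.Assembly := by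
  unfold Theses.PricedLinkCensus.Assembly
  exact closes

end Summit.AtomisticToContinuum.Crystallization.Theorems
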